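import Summits.KontsevichZagierPeriods.KontsevichZagierPeriods.Theorems.HermiteRigidityRealEllipticSectorKernelStubExactForm
import Summits.KontsevichZagierPeriods.KontsevichZagierPeriods.Theorems.EllipticMomentKernel.Negative.Roots

/-!
# `HermiteExactFormVanishes` (stmt-KontsevichZagierPeriods-3412, route HermiteRigidity)

ONE Hermite step as a move of the Kontsevich–Zagier calculus: for `q₂, q₃ ∈ ℚ` with
`q₂³ − 27q₃² > 0` (three real roots `e₃ < e₂ < e₁` of `f = 4x³ − q₂x − q₃`) and every `P ∈ ℚ[X]`,
every integral representation `r = [σ, (P′f + Pf′/2)/√f]` on the bounded real oval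
`σ = {f > 0} ∩ {∃ t > x, f t < 0} = (e₃, e₂)` satisfies `[r] ∈ KZ.relations`.

Proof: the item is the instance `g = 4X³ − q₂X − q₃`, `Q = P`, `(u, v) = (e₃, e₂)` of the general
oval engine `RealEllipticSectorKernel.stub_exactForm` (one Newton–Leibniz move with base `ℝ⁰`,
closed band `[e₃, e₂]`, primitive `P√f` vanishing at both ends; one domain-additivity move to
drop the two null endpoints; the zero base constant is a relation), once the typed set `σ` is
identified with `(e₃, e₂)` (`EllipticMomentKernelNegative.exists_roots`, `oval_eq_of_roots`: the
three located roots of a rational Weierstrass cubic with positive discriminant) and the typed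
integrand `(P′(x)·f(x) + P(x)·(12x² − q₂)/2)/√f(x)` is read as
`(P′·g + P·g′/2)/√g` evaluated at `x` (`g′ = 12X² − q₂`).
[Kontsevich–Zagier 2001, §1.2, rules (1), (3); Bostan–Lairez–Salvy 2013, §2 (Hermite reduction)]
-/

noncomputable section

open MeasureTheory Set Polynomial

namespace Summit.KontsevichZagierPeriods.HermiteRigidity.HermiteExactFormVanishes

open Literature.NumberTheory.Transcendental
open Summit.KontsevichZagierPeriods.HermiteRigidity.EllipticMomentKernelNegative
  (cubic disc oval exists_roots oval_eq_of_roots cubic_sign_of_roots)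
open Summit.KontsevichZagierPeriods.HermiteRigidity.RealEllipticSectorKernel (stub_exactForm)

/-- Evaluation of the Weierstrass cubic `4X³ − q₂X − q₃ ∈ ℚ[X]` at a real point:
`4x³ − q₂x − q₃ = cubic q₂ q₃ x`. [folklore] -/
theorem aeval_weierstrassCubic (q₂ q₃ : ℚ) (x : ℝ) :
    aeval x (4 * X ^ 3 - C q₂ * X - C q₃ : ℚ[X]) = cubic q₂ q₃ x := by
  simp [cubic, map_ofNat]

/-- Evaluation of the derivative `12X² − q₂` of the Weierstrass cubic at a real point. [folklore] -/
theorem aeval_derivative_weierstrassCubic (q₂ q₃ : ℚ) (x : ℝ) :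
    aeval x (derivative (4 * X ^ 3 - C q₂ * X - C q₃ : ℚ[X])) = 12 * x ^ 2 - (q₂ : ℝ) := by
  have h4 : derivative (4 : ℚ[X]) = 0 := derivative_ofNat 4
  simp [derivative_mul, h4, map_ofNat]
  ring

/-- **`HermiteExactFormVanishes`** (item stmt-KontsevichZagierPeriods-3412): for `q₂, q₃ ∈ ℚ`
with `q₂³ − 27q₃² > 0` and every `P ∈ ℚ[X]`, every representation
`[σ, (P′f + P f′/2)/√f]` on the bounded oval `σ = (e₃, e₂)` of `f = 4x³ − q₂x − q₃` lies in
`KZ.relations`: rule 3 with base `ℝ⁰`, band `[e₃, e₂]` and primitive `P√f` (vanishing at both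
branch points), then rule 1a across the two null endpoints — the instance `g = 4X³ − q₂X − q₃`
of `RealEllipticSectorKernel.stub_exactForm`, after identifying the typed `σ` with `(e₃, e₂)` by
the located roots of the cubic. [cite: KontsevichZagier2001, §1.2 rules (1), (3)] -/
theorem hermiteExactFormVanishes_proof :
    Summit.KontsevichZagierPeriods.KontsevichZagierPeriods.Theses.HermiteRigidity.HermiteExactFormVanishes := by
  intro q₂ q₃ hΔ P f σ r hr hri
  have hΔ' : 0 < disc q₂ q₃ := hΔ
  obtain ⟨e₃, e₂, e₁, h3, h2a, h2b, h1, hf⟩ := exists_roots hΔ'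
  have h32 : e₃ < e₂ := by linarith
  have h21 : e₂ < e₁ := by linarith
  obtain ⟨hpos, -⟩ := cubic_sign_of_roots h32 h21 hf
  have hσ : σ = {p : Fin 1 → ℝ | e₃ < p 0 ∧ p 0 < e₂} := oval_eq_of_roots h32 h21 hf
  have he₃ : cubic q₂ q₃ e₃ = 0 := by rw [hf]; ring
  have he₂ : cubic q₂ q₃ e₂ = 0 := by rw [hf]; ring
  refine stub_exactForm (4 * X ^ 3 - C q₂ * X - C q₃) P e₃ e₂ h32 ?_ ?_ ?_ r (hr.trans hσ) ?_
  · rw [aeval_weierstrassCubic]; exact he₃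
  · rw [aeval_weierstrassCubic]; exact he₂
  · intro x hx; rw [aeval_weierstrassCubic]; exact hpos x hx
  · intro p hp
    have hp' : p ∈ σ := hr ▸ hp
    rw [hri hp']
    simp only [aeval_weierstrassCubic, aeval_derivative_weierstrassCubic]
    rfl

end Summit.KontsevichZagierPeriods.HermiteRigidity.HermiteExactFormVanishes
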